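import Summits.QuantumFields.QCD.Theses.SeaNonGibbs
import HarnessLib.Audit

/-!
# Birth skeleton (BC3) for the crux `QuasilocalAfterBlocking` (item stmt-QuantumFields-8855)

Route `SeaNonGibbs` (sub-problem QCD), crux decl
`Summit.QuantumFields.QCD.Theses.SeaNonGibbs.QuasilocalAfterBlocking` (rank 3; the load-bearing hypothesis of
the route's deciding theorem `closes : QuasilocalAfterBlocking → SeaThreshold → ChiralCompletion → QCD`):

  for every `N_f ≥ 1`, `β ≥ 0`, `m ∈ (−2, 0)`, block size `M ≥ 2` and every infinite-volume sea state `μ`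
  (limit on bounded continuous cylinder observables of the periodic lifts of the unquenched Wilson torus
  measures `sea n = Z⁻¹ e^{−βS_W} |det D_W(·, m, 1)|^{N_f} dU` along a strictly increasing sequence of sides
  `Ls k + 1`), the image `μ.map block` under Bałaban's axial block-link map is consistent with SOME Feller
  specification `γ` (`IsSpecification γ ∧ Feller γ ∧ IsGibbsMeasure γ (μ.map block)`).

Registered by the skeleton-registrar seat `planner-skel-stmt-QuantumFields-8855-0` (route re-audit bin
REPAIRABLE, 2026-08-17) as `Cruxes/QuasilocalAfterBlocking/Lines/birth.lean`.  It is the route-level BIRTH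
CERTIFICATE of the crux (≥ 2 named stubs, a kernel-checked composition concluding the crux BY NAME, `sorry` only
inside `stub_*`), deliberately LINE-NEUTRAL: it cuts the crux along the classical DLR scheme for limits of
finite-volume states (Georgii Thm. 4.17, the scheme of the tree fact
`mem_ymGibbsMeasures_of_mem_infiniteVolumeLimitPoints` for the pure Wilson case), transplanted to the BLOCKED sea:

* `stub_blockedSeaLimit : BlockedSeaLimitStmt` (size M; measure-theoretic transfer) — the block map (the crux's
  inlined `block` is `axialBlockHolonomy M` of `BalabanRG.lean`) is a continuous, measurable, cylinder-preserving
  map (`isCylinder_axialBlockHolonomy_apply`), so a sea state's image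
  `μ.map block` is a probability measure and is the cylinder-weak limit of the BLOCKED torus seas
  `bsea n := (sea n).map (block ∘ torusLift (n + 1))`, which are probability measures (the sea weight is
  continuous, bounded and positive at `U = 1` for `m ∈ (−2, 0)`).
* `stub_blockSpecification : BlockSpecificationStmt` (XL; THE QCD HEART, finite volume) — along every strictly
  increasing sequence of sides on which the blocked torus seas converge (cylinder-weakly, to some probability
  measure), there is ONE Feller specification `γ` on `ZdEdge 4 → SU(3)` with which the blocked torus seas are
  ASYMPTOTICALLY DLR-CONSISTENT: `∫ (γ_Λ f) d(bsea (Ls k)) − ∫ f d(bsea (Ls k)) → 0` for every finite `Λ` and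
  bounded continuous `f`.  This is the finite-volume form of the card's mechanism (c): integrating the fine links
  compatible with the block links smears the pinned real mode of `D_W + m`, so the blocked torus kernels are
  quasilocal UNIFORMLY in the volume and converge to a Feller family (foreseen children, untyped until the fibre
  disintegration of the block map is a definition: FibreSmearing → BlockInfluenceDecay, route header TWO-LAYER PLAN).
* `stub_limitDLR : LimitDLRStmt` (size L; abstract closure lemma on the compact metrisable configuration space
  `ZdEdge 4 → SU(3)`) — a cylinder-weak limit `ν` of probability measures `ν_k` that are asymptotically
  DLR-consistent with a Feller specification `γ` is a Gibbs measure for `γ` (Stone–Weierstrass density of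
  continuous cylinder functions upgrades cylinder convergence to weak convergence; `γ_Λ f` is continuous; two
  probability measures on a metrisable Borel space with equal integrals of bounded continuous functions coincide).

`QuasilocalAfterBlocking_of : BlockedSeaLimitStmt → BlockSpecificationStmt → LimitDLRStmt → QuasilocalAfterBlocking`
(hypotheses spelled `__Registered.stub_<name>`, `rfl`-aliases of the three statements keyed by the stub names, §3)
is kernel-checked (pure logic after `intro` of the crux's `let`s) and is the ONLY theorem of the file concluding the
crux: S1 turns the sea state into a convergent sequence of blocked torus seas with limit `μ.map block`, S2 supplies
the Feller specification asymptotically consistent along that sequence, S3 closes the DLR equations in the limit.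
A closing `example` instantiates it with the three stubs (wiring check).

## Negative knowledge honoured (read 2026-08-17)
* `Cruxes/QuasilocalAfterBlocking/` had NO workfiles before this one (no `Disproof.lean`, no dead lines, no ideas);
  item notes: refuter g40-0 (survives; open-problem), grounder g18-32 (NEW; nearest template MartinelliOlivieri1995
  restoration of Gibbsianness under further decimation, acq-03301; BKL98 weak Gibbsianness is a WEAKER conclusion
  than the Feller form asked here), retriage flag "possibly over-quantified: every β ≥ 0 includes the Aoki phase".
  The skeleton keeps the crux's quantifiers verbatim (the crux is fixed); the Aoki-phase risk sits entirely in
  `stub_blockSpecification`, where it belongs.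
* `ledger negatives --problem QuantumFields`: no entry concerns specifications, block maps or sea states; no stub
  introduces a bespoke admissibility predicate; every stub is phrased over the route file's own vocabulary
  (`wilsonWeight`, `fermionDet ∘ wilsonDirac`, `torusLift`, `IsCylinder`, `Specification`, `IsSpecification`,
  `IsGibbsMeasure`) with the crux's `let`s copied byte-for-byte.
* Junk audit (typing checklist 4c): `Measure.map` is taken along `block ∘ torusLift (n+1)`, a measurable map
  (finite products of coordinates in a second-countable topological group), so `bsea` is not the zero junk
  measure — and S1 asserts `IsProbabilityMeasure (bsea (Ls k))`, which would be FALSE (not vacuous) on junk;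
  S3 assumes probability measures throughout, so `∫ 1 = 1` and no `∞`-mass junk enters; no Bochner integral
  over a free non-measurable integrand is asserted equal to anything (limits of integrals of continuous bounded
  functions against finite measures only); no hand-picked constants.

## BC3 probes (planner folder `bc/`): for each stub statement `S`, `S → QuasilocalAfterBlocking` and `S → QCD`
by `first | exact? | simpa | aesop` FAIL (files `bc/probe_<stub>_{crux,summit}.lean`; rc and goals in NOTES.md
and `Lines/birth.md`).
-/

noncomputable section

namespace Summit.QuantumFields.QCD.Cruxes.QuasilocalAfterBlocking.Birth

open scoped BigOperators Topology Classical ENNReal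
open MeasureTheory Filter
open Summit.QuantumFields.QCD.Theses.SeaNonGibbs

/-! ## §1 The three stub statements

All three are closed `Prop`s over the route file's vocabulary; the four `let`s `w, sea, block, bsea` are the
crux's own (`w, sea, block` byte-for-byte) plus the blocked torus sea `bsea n := (sea n).map (block ∘ torusLift (n+1))`. -/

/-- **(S1) Blocked sea limit** (size M). Under the crux's hypotheses on `(μ, Ls)`: the image `μ.map block` is a
probability measure, every blocked torus sea `bsea (Ls k)` is a probability measure, and the blocked torus seas
converge to `μ.map block` on bounded continuous cylinder observables (test `F ∘ block`, a bounded continuous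
cylinder observable with support `fineEdges M S`, in the hypothesis; `integral_map` along the measurable maps
`block`, `block ∘ torusLift`). Why plausibly true: routine measure theory plus `sea n ≠ 0` (the weight
`e^{−βS_W}|det D_W(U,m,1)|^{N_f}` is continuous on a compact space and positive at `U = 1`, where the free Wilson
operator has no eigenvalue `0` for `m ∈ (−2,0)`). -/
def BlockedSeaLimitStmt : Prop :=
  open Literature.MathematicalPhysics.QuantumFieldTheory Literature.MathematicalPhysics.QuantumLattice
    Literature.Probability.LatticeModels in
  ∀ Nf : ℕ, 1 ≤ Nf → ∀ β : ℝ, 0 ≤ β → ∀ m : ℝ, -2 < m → m < 0 → ∀ M : ℕ, 2 ≤ M →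
  let w : (n : ℕ) → Measure (GaugeConfig 4 (n + 1) (Matrix.specialUnitaryGroup (Fin 3) ℂ)) := fun n =>
    (wilsonWeight (d := 4) (L := n + 1) (fundamentalRep (Fin 3)) β).withDensity fun U =>
      ENNReal.ofReal (‖fermionDet (wilsonDirac (fundamentalRep (Fin 3)) U m 1)‖ ^ Nf);
  let sea : (n : ℕ) → Measure (GaugeConfig 4 (n + 1) (Matrix.specialUnitaryGroup (Fin 3) ℂ)) := fun n =>
    (w n Set.univ)⁻¹ • w n;
  let block : LGConfig 4 (Matrix.specialUnitaryGroup (Fin 3) ℂ) → LGConfig 4 (Matrix.specialUnitaryGroup (Fin 3) ℂ) :=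
    fun U b => ((List.range M).map fun t : ℕ => U ((fun i : Fin 4 => (M : ℤ) * b.1 i) + Pi.single b.2 (t : ℤ), b.2)).prod;
  let bsea : (n : ℕ) → Measure (LGConfig 4 (Matrix.specialUnitaryGroup (Fin 3) ℂ)) := fun n =>
    (sea n).map (block ∘ torusLift (n + 1));
  ∀ (μ : Measure (LGConfig 4 (Matrix.specialUnitaryGroup (Fin 3) ℂ))) (Ls : ℕ → ℕ), StrictMono Ls →
    IsProbabilityMeasure μ →
    (∀ (F : LGConfig 4 (Matrix.specialUnitaryGroup (Fin 3) ℂ) → ℝ) (S : Finset (ZdEdge 4)), IsCylinder F S →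
      Continuous F → (∃ C, ∀ U, |F U| ≤ C) →
        Tendsto (fun k : ℕ => ∫ U, F (torusLift (Ls k + 1) U) ∂(sea (Ls k))) atTop (𝓝 (∫ U, F U ∂μ))) →
    IsProbabilityMeasure (μ.map block) ∧ (∀ k : ℕ, IsProbabilityMeasure (bsea (Ls k))) ∧
      ∀ (F : LGConfig 4 (Matrix.specialUnitaryGroup (Fin 3) ℂ) → ℝ) (S : Finset (ZdEdge 4)), IsCylinder F S →
        Continuous F → (∃ C, ∀ U, |F U| ≤ C) →
          Tendsto (fun k : ℕ => ∫ V, F V ∂(bsea (Ls k))) atTop (𝓝 (∫ V, F V ∂(μ.map block)))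

/-- **(S2) Block specification — the QCD heart** (size XL; finite volume). For `N_f ≥ 1`, `β ≥ 0`,
`m ∈ (−2,0)`, `M ≥ 2` and every strictly increasing sequence of sides along which the BLOCKED torus seas converge
on bounded continuous cylinder observables to some probability measure, there is a Feller specification `γ` on
`ZdEdge 4 → SU(3)` with which the blocked torus seas are asymptotically DLR-consistent:
`∫ (∫ f dγ_Λ(η)) d(bsea (Ls k))(η) − ∫ f d(bsea (Ls k)) → 0` for every finite `Λ` and bounded continuous `f`.
Mechanism (card (c)): the blocked torus kernels have an explicit version (disintegrate product Haar along the
submersion `(u₁,…,u_M) ↦ u₁⋯u_M`); integrating the free fine links smears the pinned real eigenvalue of `D_W + m`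
over a width bounded below uniformly in the block field, so these kernels are quasilocal uniformly in the volume
and converge locally uniformly to a Feller family `γ`, which is then asymptotically consistent. Why it might
fail: exactly the crux's why-line (Aoki phase: the block-constrained fine sea at coexistence; uniform smearing
width of a pinned mode for EVERY block field). Necessary for the crux given S1/S3-type routine facts (a Feller
`γ` with `μ.map block ∈ 𝒢(γ)` is asymptotically consistent along any sequence converging to `μ.map block`). -/
def BlockSpecificationStmt : Prop :=
  open Literature.MathematicalPhysics.QuantumFieldTheory Literature.MathematicalPhysics.QuantumLattice
    Literature.Probability.LatticeModels in
  ∀ Nf : ℕ, 1 ≤ Nf → ∀ β : ℝ, 0 ≤ β → ∀ m : ℝ, -2 < m → m < 0 → ∀ M : ℕ, 2 ≤ M →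
  let w : (n : ℕ) → Measure (GaugeConfig 4 (n + 1) (Matrix.specialUnitaryGroup (Fin 3) ℂ)) := fun n =>
    (wilsonWeight (d := 4) (L := n + 1) (fundamentalRep (Fin 3)) β).withDensity fun U =>
      ENNReal.ofReal (‖fermionDet (wilsonDirac (fundamentalRep (Fin 3)) U m 1)‖ ^ Nf);
  let sea : (n : ℕ) → Measure (GaugeConfig 4 (n + 1) (Matrix.specialUnitaryGroup (Fin 3) ℂ)) := fun n =>
    (w n Set.univ)⁻¹ • w n;
  let block : LGConfig 4 (Matrix.specialUnitaryGroup (Fin 3) ℂ) → LGConfig 4 (Matrix.specialUnitaryGroup (Fin 3) ℂ) :=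
    fun U b => ((List.range M).map fun t : ℕ => U ((fun i : Fin 4 => (M : ℤ) * b.1 i) + Pi.single b.2 (t : ℤ), b.2)).prod;
  let bsea : (n : ℕ) → Measure (LGConfig 4 (Matrix.specialUnitaryGroup (Fin 3) ℂ)) := fun n =>
    (sea n).map (block ∘ torusLift (n + 1));
  ∀ (ν : Measure (LGConfig 4 (Matrix.specialUnitaryGroup (Fin 3) ℂ))) (Ls : ℕ → ℕ), StrictMono Ls →
    IsProbabilityMeasure ν → (∀ k : ℕ, IsProbabilityMeasure (bsea (Ls k))) →
    (∀ (F : LGConfig 4 (Matrix.specialUnitaryGroup (Fin 3) ℂ) → ℝ) (S : Finset (ZdEdge 4)), IsCylinder F S →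
      Continuous F → (∃ C, ∀ U, |F U| ≤ C) →
        Tendsto (fun k : ℕ => ∫ V, F V ∂(bsea (Ls k))) atTop (𝓝 (∫ V, F V ∂ν))) →
    ∃ γ : Specification (ZdEdge 4) (Matrix.specialUnitaryGroup (Fin 3) ℂ), IsSpecification γ ∧
      (∀ (Λ : Finset (ZdEdge 4)) (f : BoundedContinuousFunction (LGConfig 4 (Matrix.specialUnitaryGroup (Fin 3) ℂ)) ℝ),
        Continuous fun η : LGConfig 4 (Matrix.specialUnitaryGroup (Fin 3) ℂ) => ∫ σ, f σ ∂(γ Λ η)) ∧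
      ∀ (Λ : Finset (ZdEdge 4)) (f : BoundedContinuousFunction (LGConfig 4 (Matrix.specialUnitaryGroup (Fin 3) ℂ)) ℝ),
        Tendsto (fun k : ℕ => (∫ η, (∫ σ, f σ ∂(γ Λ η)) ∂(bsea (Ls k))) - ∫ σ, f σ ∂(bsea (Ls k)))
          atTop (𝓝 0)

/-- **(S3) DLR equations in the limit** (size L; Georgii Thm. 4.17 for asymptotically consistent sequences, on
the compact metrisable space `ZdEdge 4 → SU(3)`). If probability measures `ν_k` converge to the probability
measure `ν` on bounded continuous cylinder observables and are asymptotically DLR-consistent with a Feller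
specification `γ`, then `ν ∈ 𝒢(γ)`. Proof shape: continuous cylinder functions are uniformly dense in
`C(SU(3)^{ZdEdge 4})` (Stone–Weierstrass), so `ν_k → ν` weakly; `η ↦ γ_Λ(η) f` is bounded continuous (Feller), so
`∫ γ_Λ f dν = lim ∫ γ_Λ f dν_k = lim ∫ f dν_k = ∫ f dν`; the probability measures `νγ_Λ` and `ν` agree on bounded
continuous functions, hence (Borel = product σ-algebra for a countable product of second-countable spaces;
`HasOuterApproxClosed`) are equal, which is the junk-free DLR equation `∫⁻ γ Λ η A ∂ν = ν A`. -/
def LimitDLRStmt : Prop :=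
  open Literature.MathematicalPhysics.QuantumFieldTheory Literature.MathematicalPhysics.QuantumLattice
    Literature.Probability.LatticeModels in
  ∀ (ν : Measure (LGConfig 4 (Matrix.specialUnitaryGroup (Fin 3) ℂ)))
    (νs : ℕ → Measure (LGConfig 4 (Matrix.specialUnitaryGroup (Fin 3) ℂ))),
    IsProbabilityMeasure ν → (∀ k : ℕ, IsProbabilityMeasure (νs k)) →
    (∀ (F : LGConfig 4 (Matrix.specialUnitaryGroup (Fin 3) ℂ) → ℝ) (S : Finset (ZdEdge 4)), IsCylinder F S →
      Continuous F → (∃ C, ∀ U, |F U| ≤ C) →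
        Tendsto (fun k : ℕ => ∫ V, F V ∂(νs k)) atTop (𝓝 (∫ V, F V ∂ν))) →
    ∀ γ : Specification (ZdEdge 4) (Matrix.specialUnitaryGroup (Fin 3) ℂ), IsSpecification γ →
      (∀ (Λ : Finset (ZdEdge 4)) (f : BoundedContinuousFunction (LGConfig 4 (Matrix.specialUnitaryGroup (Fin 3) ℂ)) ℝ),
        Continuous fun η : LGConfig 4 (Matrix.specialUnitaryGroup (Fin 3) ℂ) => ∫ σ, f σ ∂(γ Λ η)) →
      (∀ (Λ : Finset (ZdEdge 4)) (f : BoundedContinuousFunction (LGConfig 4 (Matrix.specialUnitaryGroup (Fin 3) ℂ)) ℝ),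
        Tendsto (fun k : ℕ => (∫ η, (∫ σ, f σ ∂(γ Λ η)) ∂(νs k)) - ∫ σ, f σ ∂(νs k)) atTop (𝓝 0)) →
      IsGibbsMeasure γ ν

/-! ## §2 The three registered stubs (`sorry` occurs ONLY here) -/

/-- (S1) blocked sea limit — size M. -/
theorem stub_blockedSeaLimit : BlockedSeaLimitStmt := by
  sorry

/-- (S2) block specification: one Feller specification asymptotically DLR-consistent with the blocked torus
seas — size XL (the QCD heart; Aoki-phase risk lives here). -/
theorem stub_blockSpecification : BlockSpecificationStmt := by
  sorry

/-- (S3) DLR equations in the cylinder-weak limit for Feller specifications — size L. -/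
theorem stub_limitDLR : LimitDLRStmt := by
  sorry

/-! ## §3 Name-keyed aliases of the three statements — the hypotheses of `QuasilocalAfterBlocking_of`

The native skeleton audit (`#h21_check_skeleton`, run by `ledger skeleton check`) admits a hypothesis of the skeleton
theorem only if its head constant is a registered obligation or is NAMED like a declared stub; `__Registered.stub_X`
is the statement of `stub_X` under that name (device of `CriticalPhenomena/SAWScalingLimit/…/AxiomsOfLimit/Lines/birth.lean`
and `RiemannHypothesis/…/Lines/pencil_bracket_count.lean`: the `__` namespace is an implementation detail, so the
audit's stub report resolves each `stub_…` to the sorried theorem, not to the alias; the gate-reserved `@[stub]`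
attribute is not written by a planner). Each alias is `rfl`-equal to its statement. -/
namespace __Registered

/-- Alias of `BlockedSeaLimitStmt` keyed by the registered stub name. -/
abbrev stub_blockedSeaLimit : Prop := BlockedSeaLimitStmt
/-- Alias of `BlockSpecificationStmt` keyed by the registered stub name. -/
abbrev stub_blockSpecification : Prop := BlockSpecificationStmt
/-- Alias of `LimitDLRStmt` keyed by the registered stub name. -/
abbrev stub_limitDLR : Prop := LimitDLRStmt

end __Registered

/-! ## §4 Composition (kernel-checked; no `sorry` below this line; the ONLY theorem concluding the crux) -/

/-- **The crux from the three stubs** (concludes `QuasilocalAfterBlocking` BY NAME; hypotheses = the three stub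
statements under their registered names). After introducing the crux's parameters, `let`s and sea-state
hypotheses: S1 gives that `μ.map block` and the blocked torus seas `bsea (Ls k)` are probability measures with
`bsea (Ls k) → μ.map block` cylinder-weakly; S2, fed with that convergent sequence, gives a Feller specification `γ`
asymptotically DLR-consistent along it; S3 closes the DLR equations in the limit: `IsGibbsMeasure γ (μ.map block)`. -/
theorem QuasilocalAfterBlocking_of (h1 : __Registered.stub_blockedSeaLimit)
    (h2 : __Registered.stub_blockSpecification) (h3 : __Registered.stub_limitDLR) :
    QuasilocalAfterBlocking := by
  intro Nf hNf β hβ m hm₁ hm₂ M hM w sea block μ Ls hLs hμ hconv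
  obtain ⟨hprob, hprobk, hlim⟩ := h1 Nf hNf β hβ m hm₁ hm₂ M hM μ Ls hLs hμ hconv
  obtain ⟨γ, hγ, hFeller, hcons⟩ := h2 Nf hNf β hβ m hm₁ hm₂ M hM (μ.map block) Ls hLs hprob hprobk hlim
  exact ⟨γ, hγ, hFeller, h3 (μ.map block) _ hprob hprobk hlim γ hγ hFeller hcons⟩

/-- Wiring check (an `example`, so that `QuasilocalAfterBlocking_of` stays the only theorem concluding the crux):
the registered stubs feed the skeleton theorem as stated — this term becomes the crux proof when the three
`sorry`s above are discharged. -/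
example : QuasilocalAfterBlocking :=
  QuasilocalAfterBlocking_of stub_blockedSeaLimit stub_blockSpecification stub_limitDLR

end Summit.QuantumFields.QCD.Cruxes.QuasilocalAfterBlocking.Birth

end
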